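import Literature.AlgebraicGeometry.HodgeTheory.CotangentSheafPullbackHomCharts
import Literature.AlgebraicGeometry.HodgeTheory.AtiyahClassCoherent
import Literature.AlgebraicGeometry.Modules.SheafHomAffineSections
import Literature.AlgebraicGeometry.Motives.CotangentSheafAffineLocalizing
import Literature.AlgebraicGeometry.Motives.DifferentialsProofs
import HarnessLib

/-!
# Sections of the tangent sheaf over an affine open are the derivations of its coordinate ring:
# `Γ(V, 𝒯_{X/S}) = Der_S(Γ(V, 𝒪_X), Γ(V, 𝒪_X))`

Layer `Literature/AlgebraicGeometry/HodgeTheory` (cell hodgecm-mathlib, SOCKETS-F §4 (α) node E2-c/d, brick K1;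
count-neutral capital). For an `S`-scheme `X : Over (Spec S)` the tree's tangent sheaf is
`tangentSheaf X = 𝓗om(Ω¹_{X/S}, 𝒪_X)` (`HodgeTheory/AtiyahClassCoherent`), whose sections over an open `V` are the
morphisms `θ : Ω¹_{X/S}|_V ⟶ 𝒪_X|_V` of restricted modules (`Modules/SheafHom`). Every such `θ` defines the
`S`-derivation `a ↦ θ(da)` of `Γ(V, 𝒪_X)` (Leibniz rule and vanishing on constants: §1, any open `V`; compatible with
restriction: `map_appLE_dSection`). On an AFFINE open `V` this is a bijection
`Γ(V, 𝒯_{X/S}) ≅ Der_S(Γ(V, 𝒪_X), Γ(V, 𝒪_X))` (Hartshorne II.8, p. 180 with II Prop. 5.2 and Remark 8.9.2: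
`𝒯|_V = Hom(Ω_{B/S}, B)~ = Der_S(B, B)~` for `V = Spec B`):

* `tangentSheaf_hom_ext_of_isAffineOpen` — two sections of `𝒯_{X/S}` over an affine `V` with the same values on
  the exact forms `da`, `a ∈ Γ(V, 𝒪_X)`, are equal (`Modules/SheafHomAffineSections.evalHom_injective` for the
  affine-localizing `Ω¹`, `Motives/CotangentSheafAffineLocalizing`, and `Γ(V, Ω¹) = Γ(V, 𝒪)·dΓ(V, 𝒪)`,
  `HodgeTheory/CotangentSheafPullbackHomCharts.span_range_dSection_eq_top`);
* `exists_tangentSheaf_section_of_leibniz` / `existsUnique_tangentSheaf_section_of_leibniz` — every additive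
  `D : Γ(V, 𝒪_X) → Γ(V, 𝒪_X)` with the Leibniz rule and `D|_S = 0` is `a ↦ θ(da)` for a unique section `θ`
  (the universal property of `Ω_{Γ(V)/S}`, Mathlib `Derivation.liftKaehlerDifferential`, transported along
  `Γ(V, Ω¹) = Ω_{Γ(V)/S}`, the tree's `Motives.bijective_toCotangentSheaf_app_holds`, and extended to a morphism of
  restricted modules by `Modules/SheafHomAffineSections.homOfLinear`);
* `existsUnique_tangentSheaf_section_of_derivation` — the same for a Mathlib `Derivation S Γ(V, 𝒪_X) Γ(V, 𝒪_X)`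
  (any `Algebra S Γ(V, 𝒪_X)` instance whose structure map is the scheme's, `halg`; e.g. `(constToPresheaf X).toAlgebra`
  with `halg := fun _ => rfl`).

* `tangentSheaf_hom_ext_basicOpen_of_isAffineOpen` / `tangentSheaf_hom_ext_of_le_isAffineOpen` (§4) — over a
  principal open `D(f)`, resp. ANY open `W`, inside an affine `V`, a section of `𝒯` is determined by the
  derivation `a ↦ θ(d(a|_W))` of `Γ(V, 𝒪_X)` (`Γ(D(f)) = Γ(V)_f`; `W` is covered by principal opens of `V`) — the
  input for restricting torsor identities from an affine open to the affine opens inside it.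

Theorems only (no definitions, no named facts). Consumers: the Kodaira–Spencer class of a first-order deformation
(local retractions form a torsor under these derivations) and the obstruction to lifting morphisms into a smooth
target (SGA 3 III 5.1).

## References

* [Hartshorne1977] R. Hartshorne, *Algebraic Geometry*, GTM 52 (1977): II.8 p. 180 (the tangent sheaf
  `𝒯_X = 𝓗om(Ω_{X/k}, 𝒪_X)`), II Prop. 5.2 (p. 110), II Remark 8.9.2 (p. 176), II.8 p. 172 (`Ω_{B/A}`, `Der_A(B, M) =
  Hom_B(Ω_{B/A}, M)`).
-/

noncomputable section

open CategoryTheory AlgebraicGeometry Opposite TopologicalSpace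

universe u

namespace Literature.AlgebraicGeometry.HodgeTheory

open Literature.AlgebraicGeometry.Modules Literature.AlgebraicGeometry.Motives

variable {S : Type u} [CommRing S] {X : Over (Spec (CommRingCat.of S))} {V W : X.left.Opens}

/-! ### §1 The derivation `a ↦ θ(da)` of a section `θ` of the tangent sheaf (any open) -/

/-- `θ(d(a + b)) = θ(da) + θ(db)`. [cite: Hartshorne1977, II.8 p. 172 and p. 180] -/
theorem appLE_dSection_add (θ : (cotangentSheaf X).over V ⟶ (unitModule X.left).over V) (a b : Γ(X.left, V)) :
    appLE θ (𝟙 V) (dSection X V (a + b)) = appLE θ (𝟙 V) (dSection X V a) + appLE θ (𝟙 V) (dSection X V b) := by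
  rw [dSection_add, appLE_add_right]

/-- **Leibniz rule** `θ(d(ab)) = a θ(db) + b θ(da)` (the scalar action of `Γ(V, 𝒪_X)` on `Γ(V, 𝒪_X|_V)` is
multiplication). [cite: Hartshorne1977, II.8 p. 172 and p. 180] -/
theorem appLE_dSection_mul (θ : (cotangentSheaf X).over V ⟶ (unitModule X.left).over V) (a b : Γ(X.left, V)) :
    appLE θ (𝟙 V) (dSection X V (a * b)) =
      a • appLE θ (𝟙 V) (dSection X V b) + b • appLE θ (𝟙 V) (dSection X V a) := by
  rw [dSection_mul, appLE_add_right, appLE_smul_right, appLE_smul_right]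

/-- Leibniz rule, multiplicative form in `Γ(V, 𝒪_X)`. [cite: Hartshorne1977, II.8 p. 172 and p. 180] -/
theorem appLE_dSection_mul' (θ : (cotangentSheaf X).over V ⟶ (unitModule X.left).over V) (a b : Γ(X.left, V)) :
    (show Γ(X.left, V) from appLE θ (𝟙 V) (dSection X V (a * b))) =
      a * (show Γ(X.left, V) from appLE θ (𝟙 V) (dSection X V b)) +
        b * (show Γ(X.left, V) from appLE θ (𝟙 V) (dSection X V a)) := by
  rw [appLE_dSection_mul]
  rfl

/-- `d` kills the constants: `d(s · 1) = 0` for `s ∈ S`. [cite: Hartshorne1977, II.8 p. 172] -/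
theorem dSection_constToPresheaf_app (s : S) :
    dSection X V ((constToPresheaf X).app (op V) s) = 0 :=
  (dCotangent X).d_app (X := op V) s

/-- `θ(d s) = 0` for a constant `s ∈ S`. [cite: Hartshorne1977, II.8 p. 172 and p. 180] -/
theorem appLE_dSection_constToPresheaf_app (θ : (cotangentSheaf X).over V ⟶ (unitModule X.left).over V) (s : S) :
    appLE θ (𝟙 V) (dSection X V ((constToPresheaf X).app (op V) s)) = 0 := by
  rw [dSection_constToPresheaf_app, appLE_zero_right]

/-- `θ(d1) = 0`. [cite: Hartshorne1977, II.8 p. 172] -/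
theorem appLE_dSection_one (θ : (cotangentSheaf X).over V ⟶ (unitModule X.left).over V) :
    appLE θ (𝟙 V) (dSection X V 1) = 0 := by
  rw [dSection_one, appLE_zero_right]

/-- **Compatibility with restriction**: `θ(da)|_W = θ|_W(d(a|_W))` for `i : W ⟶ V`.
[cite: Hartshorne1977, II.8 p. 175 (compatibility of `d` with localisation) and p. 180] -/
theorem map_appLE_dSection (i : W ⟶ V) (θ : (cotangentSheaf X).over V ⟶ (unitModule X.left).over V)
    (a : Γ(X.left, V)) :
    X.left.presheaf.map i.op (appLE θ (𝟙 V) (dSection X V a) : Γ(X.left, V)) =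
      appLE (restrictHom i θ) (𝟙 W) (dSection X W (X.left.presheaf.map i.op a)) := by
  have h := appLE_map θ (𝟙 V) i (dSection X V a)
  rw [map_dSection, Category.comp_id] at h
  rw [appLE_restrictHom, Category.id_comp, h]
  rfl

/-! ### §2 Affine opens: a section of `𝒯` is determined by its values on the `da` -/

/-- **On an affine open `V`, a section `θ ∈ Γ(V, 𝒯_{X/S})` is determined by the derivation `a ↦ θ(da)` of
`Γ(V, 𝒪_X)`** (`Hom(Ω¹|_V, 𝒪|_V) = Hom_{Γ(V)}(Γ(V, Ω¹), Γ(V))` for the affine-localizing `Ω¹`, and `Γ(V, Ω¹)` is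
spanned by the `da`). [cite: Hartshorne1977, II Prop. 5.2 (p. 110) and II Remark 8.9.2 (p. 176)] -/
theorem tangentSheaf_hom_ext_of_isAffineOpen (hV : IsAffineOpen V)
    {θ θ' : (cotangentSheaf X).over V ⟶ (unitModule X.left).over V}
    (h : ∀ a : Γ(X.left, V), appLE θ (𝟙 V) (dSection X V a) = appLE θ' (𝟙 V) (dSection X V a)) :
    θ = θ' := by
  apply evalHom_injective (isAffineLocalizing_cotangentSheaf X) hV
  refine LinearMap.ext_on_range (span_range_dSection_eq_top X hV) fun a => ?_
  rw [evalHom_apply, evalHom_apply]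
  exact h a

/-- On an affine open, `θ = 0` iff `θ(da) = 0` for all `a ∈ Γ(V, 𝒪_X)`.
[cite: Hartshorne1977, II Prop. 5.2 (p. 110) and II Remark 8.9.2 (p. 176)] -/
theorem tangentSheaf_section_eq_zero_iff_of_isAffineOpen (hV : IsAffineOpen V)
    (θ : (cotangentSheaf X).over V ⟶ (unitModule X.left).over V) :
    θ = 0 ↔ ∀ a : Γ(X.left, V), appLE θ (𝟙 V) (dSection X V a) = 0 :=
  ⟨fun h a => by rw [h, appLE_zero], fun h => tangentSheaf_hom_ext_of_isAffineOpen hV fun a => by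
    rw [h a, appLE_zero]⟩

/-! ### §3 Affine opens: every derivation of `Γ(V, 𝒪_X)` is `a ↦ θ(da)` -/

/-- **Every `S`-derivation of the coordinate ring of an affine open is `a ↦ θ(da)` for a section `θ` of the
tangent sheaf** — bare form: `D` additive, Leibniz, vanishing on the image of `S`. (The universal property of
`Ω_{Γ(V)/S}` gives a `Γ(V)`-linear form on `Γ(V, Ω¹) = Ω_{Γ(V)/S}`, which extends uniquely to `Ω¹|_V ⟶ 𝒪|_V`.)
[cite: Hartshorne1977, II.8 p. 172 (`Hom_B(Ω_{B/A}, M) = Der_A(B, M)`), II Prop. 5.2 (p. 110), II Remark 8.9.2 (p. 176)] -/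
theorem exists_tangentSheaf_section_of_leibniz (hV : IsAffineOpen V) (D : Γ(X.left, V) → Γ(X.left, V))
    (hadd : ∀ a b, D (a + b) = D a + D b) (hmul : ∀ a b, D (a * b) = a * D b + b * D a)
    (hconst : ∀ s : S, D ((constToPresheaf X).app (op V) s) = 0) :
    ∃ θ : (cotangentSheaf X).over V ⟶ (unitModule X.left).over V,
      ∀ a, (appLE θ (𝟙 V) (dSection X V a) : Γ(X.left, V)) = D a := by
  classical
  letI algV : Algebra S Γ(X.left, V) :=
    (((constToPresheaf X).app (op V)).hom : S →+* Γ(X.left, V)).toAlgebra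
  have halg : ∀ s : S, algebraMap S Γ(X.left, V) s = (constToPresheaf X).app (op V) s := fun _ => rfl
  -- `D` as an `S`-derivation of `B = Γ(V, 𝒪_X)`
  let Dₗ : Γ(X.left, V) →ₗ[S] Γ(X.left, V) :=
    { toFun := D
      map_add' := hadd
      map_smul' := fun s a => by
        rw [RingHom.id_apply, Algebra.smul_def, Algebra.smul_def, hmul, halg, hconst, mul_zero, add_zero] }
  let Dd : Derivation S Γ(X.left, V) Γ(X.left, V) :=
    Derivation.mk' Dₗ fun a b => by
      change D (a * b) = a * D b + b * D a
      exact hmul a b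
  have hDd : ∀ a, Dd a = D a := fun _ => rfl
  -- the `B`-linear form `Ω_{B/S} → B` it induces
  have hℓ₀ : ∀ a, Dd.liftKaehlerDifferential (KaehlerDifferential.D S Γ(X.left, V) a) = D a := fun a => by
    rw [Derivation.liftKaehlerDifferential_comp_D, hDd]
  -- transport along the bijection `e : Ω_{B/S} → Γ(V, Ω¹)`
  let e : Ω[Γ(X.left, V)⁄S] → Γ(cotangentSheaf X, V) := fun ζ => (toCotangentSheaf X).app (op V) ζ
  have he_add : ∀ ζ ζ' : Ω[Γ(X.left, V)⁄S], e (ζ + ζ') = e ζ + e ζ' := fun ζ ζ' =>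
    ((toCotangentSheaf X).app (op V)).hom.map_add ζ ζ'
  have he_smul : ∀ (r : Γ(X.left, V)) (ζ : Ω[Γ(X.left, V)⁄S]), e (r • ζ) = r • e ζ := fun r ζ =>
    ((toCotangentSheaf X).app (op V)).hom.map_smul r ζ
  have he_d : ∀ a : Γ(X.left, V), e (KaehlerDifferential.D S Γ(X.left, V) a) = dSection X V a := fun _ => rfl
  have hbij : Function.Bijective e := bijective_toCotangentSheaf_app_holds X hV
  obtain ⟨g, hlg, hrg⟩ := Function.bijective_iff_has_inverse.mp hbij
  have hrg' : ∀ ω, e (g ω) = ω := hrg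
  have hg_add : ∀ ω ω' : Γ(cotangentSheaf X, V), g (ω + ω') = g ω + g ω' := fun ω ω' =>
    hbij.1 (by rw [hrg', he_add, hrg', hrg'])
  have hg_smul : ∀ (r : Γ(X.left, V)) (ω : Γ(cotangentSheaf X, V)), g (r • ω) = r • g ω := fun r ω =>
    hbij.1 (by rw [hrg', he_smul, hrg'])
  have hg_d : ∀ a : Γ(X.left, V), g (dSection X V a) = KaehlerDifferential.D S Γ(X.left, V) a := fun a =>
    hbij.1 (by rw [hrg', he_d])
  let ℓ : Γ(cotangentSheaf X, V) →ₗ[Γ(X.left, V)] Γ(unitModule X.left, V) :=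
    { toFun := fun ω => (show Γ(unitModule X.left, V) from Dd.liftKaehlerDifferential (g ω))
      map_add' := fun ω ω' => by
        change Dd.liftKaehlerDifferential (g (ω + ω')) =
          Dd.liftKaehlerDifferential (g ω) + Dd.liftKaehlerDifferential (g ω')
        rw [hg_add, map_add]
      map_smul' := fun r ω => by
        change Dd.liftKaehlerDifferential (g (r • ω)) = r * Dd.liftKaehlerDifferential (g ω)
        rw [hg_smul, map_smul, smul_eq_mul] }
  have hℓ : ∀ a, (ℓ (dSection X V a) : Γ(X.left, V)) = D a := fun a => by
    change Dd.liftKaehlerDifferential (g (dSection X V a)) = D a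
    rw [hg_d, hℓ₀]
  refine ⟨homOfLinear (isAffineLocalizing_cotangentSheaf X) hV ℓ, fun a => ?_⟩
  rw [← evalHom_apply, evalHom_homOfLinear]
  exact hℓ a

/-- **`Γ(V, 𝒯_{X/S}) = Der_S(Γ(V, 𝒪_X), Γ(V, 𝒪_X))` on an affine open `V`**, bare form: existence and uniqueness
of the section with prescribed derivation `a ↦ θ(da) = D a`.
[cite: Hartshorne1977, II.8 p. 180 (tangent sheaf) with II Prop. 5.2 (p. 110) and II Remark 8.9.2 (p. 176)] -/
theorem existsUnique_tangentSheaf_section_of_leibniz (hV : IsAffineOpen V) (D : Γ(X.left, V) → Γ(X.left, V))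
    (hadd : ∀ a b, D (a + b) = D a + D b) (hmul : ∀ a b, D (a * b) = a * D b + b * D a)
    (hconst : ∀ s : S, D ((constToPresheaf X).app (op V) s) = 0) :
    ∃! θ : (cotangentSheaf X).over V ⟶ (unitModule X.left).over V,
      ∀ a, (appLE θ (𝟙 V) (dSection X V a) : Γ(X.left, V)) = D a := by
  obtain ⟨θ, hθ⟩ := exists_tangentSheaf_section_of_leibniz hV D hadd hmul hconst
  exact ⟨θ, hθ, fun θ' hθ' => tangentSheaf_hom_ext_of_isAffineOpen hV fun a => by rw [hθ' a, hθ a]⟩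

/-- **`Γ(V, 𝒯_{X/S}) = Der_S(Γ(V, 𝒪_X), Γ(V, 𝒪_X))` on an affine open `V`**, for a Mathlib `Derivation` of the
coordinate ring `Γ(V, 𝒪_X)` with its `S`-algebra structure `constToPresheaf X`.
[cite: Hartshorne1977, II.8 p. 180 (tangent sheaf) with II Prop. 5.2 (p. 110) and II Remark 8.9.2 (p. 176)] -/
theorem existsUnique_tangentSheaf_section_of_derivation (hV : IsAffineOpen V) [Algebra S Γ(X.left, V)]
    (halg : ∀ s : S, algebraMap S Γ(X.left, V) s = (constToPresheaf X).app (op V) s)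
    (D : Derivation S Γ(X.left, V) Γ(X.left, V)) :
    ∃! θ : (cotangentSheaf X).over V ⟶ (unitModule X.left).over V,
      ∀ a, (appLE θ (𝟙 V) (dSection X V a) : Γ(X.left, V)) = D a := by
  refine existsUnique_tangentSheaf_section_of_leibniz hV D (map_add D)
    (fun a b => by rw [D.leibniz, smul_eq_mul, smul_eq_mul]) fun s => ?_
  rw [← halg]
  exact D.map_algebraMap s


/-! ### §4 Opens inside an affine open: a section of `𝒯` is determined by the derivation restricted from `Γ(V)` -/

/-- **On a principal open `D(f)` of an affine `V`, a section of `𝒯` is determined by its values on the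
`d(a|_{D(f)})`, `a ∈ Γ(V, 𝒪_X)`** (`Γ(D(f)) = Γ(V)_f`: for `c = a/fⁿ`, `fⁿ θ(dc) = θ(d(a|)) − c θ(d(fⁿ|))`).
[cite: Hartshorne1977, II.8 p. 175 (`Ω_{S⁻¹B/A} = S⁻¹Ω_{B/A}`) with II Prop. 5.2 (p. 110)] -/
theorem tangentSheaf_hom_ext_basicOpen_of_isAffineOpen (hV : IsAffineOpen V) (f : Γ(X.left, V))
    {θ θ' : (cotangentSheaf X).over (X.left.basicOpen f) ⟶ (unitModule X.left).over (X.left.basicOpen f)}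
    (h : ∀ a : Γ(X.left, V),
      appLE θ (𝟙 _) (dSection X (X.left.basicOpen f) (X.left.presheaf.map (homOfLE (X.left.basicOpen_le f)).op a)) =
        appLE θ' (𝟙 _) (dSection X (X.left.basicOpen f) (X.left.presheaf.map (homOfLE (X.left.basicOpen_le f)).op a))) :
    θ = θ' := by
  haveI := hV.isLocalization_basicOpen f
  -- notation: `res a = a|_{D(f)}` is the algebra map `Γ(V) → Γ(D(f)) = Γ(V)_f`
  have hres : ∀ a : Γ(X.left, V), algebraMap Γ(X.left, V) Γ(X.left, X.left.basicOpen f) a =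
      X.left.presheaf.map (homOfLE (X.left.basicOpen_le f)).op a := fun _ => rfl
  refine tangentSheaf_hom_ext_of_isAffineOpen (hV.basicOpen f) fun c => ?_
  obtain ⟨⟨a, ⟨_, n, rfl⟩⟩, hc⟩ := IsLocalization.surj (Submonoid.powers f) c
  -- `hc : c * res (f ^ n) = res a`
  simp only at hc
  rw [hres, hres] at hc
  have hunit : IsUnit (X.left.presheaf.map (homOfLE (X.left.basicOpen_le f)).op (f ^ n)) := by
    rw [← hres, map_pow]
    exact (IsLocalization.Away.algebraMap_isUnit f).pow n
  -- apply `θ ∘ d` and `θ' ∘ d` to `hc`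
  have key : ∀ ψ : (cotangentSheaf X).over (X.left.basicOpen f) ⟶ (unitModule X.left).over (X.left.basicOpen f),
      c • appLE ψ (𝟙 _) (dSection X _ (X.left.presheaf.map (homOfLE (X.left.basicOpen_le f)).op (f ^ n))) +
          X.left.presheaf.map (homOfLE (X.left.basicOpen_le f)).op (f ^ n) • appLE ψ (𝟙 _) (dSection X _ c) =
        appLE ψ (𝟙 _) (dSection X _ (X.left.presheaf.map (homOfLE (X.left.basicOpen_le f)).op a)) := fun ψ => by
    rw [← appLE_dSection_mul, hc]
  have e1 := key θ
  have e2 := key θ'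
  rw [h (f ^ n), h a, ← e2] at e1
  -- cancel the common first summand and the unit `res (fⁿ)`
  have e3 := add_left_cancel e1
  obtain ⟨u, hu⟩ := hunit
  rw [← hu] at e3
  have e4 := congrArg (fun y => ((u⁻¹ : (Γ(X.left, X.left.basicOpen f))ˣ) : Γ(X.left, X.left.basicOpen f)) • y) e3
  simp only [← mul_smul, Units.inv_mul, one_smul] at e4
  exact e4

/-- **On any open `W` inside an affine open `V`, a section `θ ∈ Γ(W, 𝒯_{X/S})` is determined by the derivation
`a ↦ θ(d(a|_W))` of `Γ(V, 𝒪_X)`** (cover `W` by principal opens of `V` and use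
`tangentSheaf_hom_ext_basicOpen_of_isAffineOpen`; `𝒪_X` is a sheaf).
[cite: Hartshorne1977, II.8 p. 175 and p. 180, with II Prop. 5.2 (p. 110)] -/
theorem tangentSheaf_hom_ext_of_le_isAffineOpen (hV : IsAffineOpen V) (hWV : W ≤ V)
    {θ θ' : (cotangentSheaf X).over W ⟶ (unitModule X.left).over W}
    (h : ∀ a : Γ(X.left, V), appLE θ (𝟙 W) (dSection X W (X.left.presheaf.map (homOfLE hWV).op a)) =
      appLE θ' (𝟙 W) (dSection X W (X.left.presheaf.map (homOfLE hWV).op a))) :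
    θ = θ' := by
  -- restrictions to the principal opens `D(f) ≤ W` of `V` agree
  have hD : ∀ (f : Γ(X.left, V)) (hf : X.left.basicOpen f ≤ W),
      restrictHom (homOfLE hf) θ = restrictHom (homOfLE hf) θ' := fun f hf => by
    refine tangentSheaf_hom_ext_basicOpen_of_isAffineOpen hV f fun a => ?_
    have ha : X.left.presheaf.map (homOfLE (X.left.basicOpen_le f)).op a =
        X.left.presheaf.map (homOfLE hf).op (X.left.presheaf.map (homOfLE hWV).op a) := by
      rw [← CommRingCat.comp_apply, ← X.left.presheaf.map_comp]
      rfl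
    rw [ha, ← map_appLE_dSection, ← map_appLE_dSection, h a]
  refine hom_ext_of_appLE fun W₀ k s => ?_
  -- cover `W₀` by the principal opens of `V` inside it
  let ι := {f : Γ(X.left, V) // X.left.basicOpen f ≤ W₀}
  let U : ι → X.left.Opens := fun f => X.left.basicOpen f.1
  have hcov : W₀ ≤ iSup U := fun x hx => by
    obtain ⟨f, hfW, hxf⟩ := hV.exists_basicOpen_le ⟨x, hx⟩ ((k.le.trans hWV) hx)
    exact Opens.mem_iSup.mpr ⟨⟨f, hfW⟩, hxf⟩
  refine TopCat.Sheaf.eq_of_locally_eq' ((SheafOfModules.toSheaf _).obj (unitModule X.left)) U W₀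
    (fun f => homOfLE f.2) hcov _ _ fun f => ?_
  change (unitModule X.left).presheaf.map (homOfLE f.2).op (appLE θ k s) =
    (unitModule X.left).presheaf.map (homOfLE f.2).op (appLE θ' k s)
  rw [← appLE_map, ← appLE_map,
    show homOfLE f.2 ≫ k = 𝟙 _ ≫ homOfLE (f.2.trans k.le) from Subsingleton.elim _ _,
    ← appLE_restrictHom, ← appLE_restrictHom, hD f.1 (f.2.trans k.le)]

end Literature.AlgebraicGeometry.HodgeTheory

end
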